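import Mathlib.Topology.Algebra.Group.Basic
import Literature.AnabelianGeometry.SemiGraphs.ArithMaximalCompact
import HarnessLib

/-!
# [NodNon] Prop 3.9 (i) in ARITHMETIC coset coordinates — the pro-vertex trichotomy «coincide / adjacent / common
# adjacent vertex» for the closures of the verticial decomposition groups of [SemiAnbd] §5 data (the arithmetic twin of
# `PSCDatum.VerticialIntersectionNear`, F-2540); one `Prop`-valued predicate, nothing asserted

Y. Hoshi, S. Mochizuki, *On the combinatorial anabelian geometry of nodally nondegenerate outer representations*,
Hiroshima Math. J. **41** (2011) 275–342, kurims manuscript `paper:url-7d2bac4a77b4` ("[NodNon]" in the IUT corpus).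
Setting of §3 (ms p. 36 l. 24–28, BYTE-VERBATIM from the filer's own render): «In this section, let Σ be a nonempty
set of prime numbers, G a semi-graph of anabelioids of pro-Σ PSC-type, Π_G the fundamental group of G, ρ_I : I →
Aut(G) an outer representation of NN-type, and Π_I := Π_G ⋊^out I.»  The statement typed here (ms p. 48 l. 10–25,
BYTE-VERBATIM, `[…]` = the filer's substitutions of lost glyphs):

> **Proposition 3.9 (Graph-theoretic geometry via verticial decomposition subgroups).** For i = 1, 2, let
> ṽᵢ ∈ Vert(G̃). Then the following hold:
> (i) Consider the following four (mutually exclusive) conditions: (1) δ(ṽ₁, ṽ₂) = 0. (2) δ(ṽ₁, ṽ₂) = 1.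
> (3) δ(ṽ₁, ṽ₂) = 2. (4) δ(ṽ₁, ṽ₂) ≥ 3. Then we have equivalences (1) ⟺ (1′); (2) ⟺ (2′); (3) ⟺ (3′);
> (4) ⟺ (4′) with the following four (mutually exclusive [cf. Lemma 1.9, (ii)]) conditions:
> (1′) Π_ṽ₁ = Π_ṽ₂ (so D_ṽ₁ = D_ṽ₂, I_ṽ₁ = I_ṽ₂). (2′) Π_ṽ₁ ≠ Π_ṽ₂; Π_ṽ₁ ∩ Π_ṽ₂ (= D_ṽ₁ ∩ D_ṽ₂ ∩ Π_G) ≠ {1}.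
> (3′) Π_ṽ₁ ∩ Π_ṽ₂ (= D_ṽ₁ ∩ D_ṽ₂ ∩ Π_G) = {1}; D_ṽ₁ ∩ D_ṽ₂ ≠ {1}. (4′) D_ṽ₁ ∩ D_ṽ₂ = {1}.

[cite: HoshiMochizukiNodNon2011, Prop 3.9 (i) p.48]  The consequence consumed by [IUTchI] (proof of Prop. 2.4 (ii),
kurims p. 50 l. 64 – p. 51 l. 8: «when one applies either [AbsTopII], Proposition 1.3, (iv), or [NodNon], Proposition
3.9, (i) … to the vertices "v″", "(v′)^γ", one may only conclude that these two vertices either coincide, are adjacent,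
or admit a common adjacent vertex; but this is still sufficient to conclude the temperedness of "(v′)^γ" from that of
"v″"») is ¬(4′) ⇒ ¬(4), i.e. **`D_ṽ₁ ∩ D_ṽ₂ ≠ {1}` ⇒ `δ(ṽ₁, ṽ₂) ≤ 2`**: the two pro-vertices COINCIDE, are ADJACENT (the
end-points of one pro-node, [NodNon] Def 1.1 (vi) p. 285, Lem 1.7 / Lem 1.8 p. 290), or ADMIT A COMMON ADJACENT
pro-vertex.  [AbsTopII] Prop. 1.3 (iv) p. 11 (S. Mochizuki, *Topics in absolute anabelian geometry II*) is the same
trichotomy with its refined clauses «for appropriate choices of conjugates» [cite: MochizukiAbsTopII2013, Prop 1.3 (iv) p.11];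
its vertex-level half is abc-iut-L4's `DPSCData.Prop13iv'` (F-0276 lineage; refined clauses cross-referenced there only).

## How it is typed, and why in this shape

This is the ARITHMETIC TWIN of `PSCDatum.VerticialIntersectionNear` (F-2540; [NodNon] Lem 1.9 (ii) in coset coordinates,
`NodNonVerticialGeometry.lean` — not edited): the universal covering is not an object of the tree, so pro-vertices are
written in COSET COORDINATES over the [SemiAnbd] §5 data `D : DecompositionData Gtp V B` (`ArithMaximalCompact.lean`,
p. 65: `Gtp` = the arithmetic tempered group `Π^temp_𝔊`, `D.vertGp v` = a representative verticial decomposition group,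
`D.brGp b` = a branch decomposition group): with `ι : Gtp →* Ghat` the map to the profinite ambient (interface ruling (C),
abc-iut-L3-lead 2026-08-27T05:47Z: the pro-vertex stabilisers are the CLOSURES `closure ι(D_v) ≤ Ghat`, never a profinite
completion of the restriction), the pro-vertices over `v` are the `g · closure ι(D_v) · g⁻¹`, `g ∈ Ghat`; ENDPOINT DATA of
`D` (an index type `E` of nodes; for each node two DISTINCT branches `β₁ e ≠ β₂ e` of ONE edge abutting to `src e`,
`tgt e`; tempered end-point conjugators `c₁ e, c₂ e ∈ Gtp` with `c₁·Π_{β₁ e}·c₁⁻¹ = c₂·Π_{β₂ e}·c₂⁻¹` — the reference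
pro-node; the no-loop clause, Lem 1.8; coverage of every node) are quantified UNIVERSALLY, exactly as in the consumer.
The hypothesis «`D_ṽ₁ ∩ D_ṽ₂ ≠ {1}`» is rendered in the form [IUTchI] uses it — the two stabilisers contain a common
`Ghat`-conjugate `γ · π(Λ) · γ⁻¹` of the image of a COMPACT, NON-TRIVIAL subgroup `Λ` of a source group `Gsrc`
(`π : Gsrc →* Ghat`; in the consumer `Gsrc = Π^temp_{X_K}`, `π = Π^temp_{X_K} → Π̂_j`) whose image under the augmentation
`aug : Gsrc →* GK` is OPEN («after restricting … to a closed pro-Σ subgroup of the inertia group», p. 51 l. 1–2) — and the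
conclusion «coincide ∨ adjacent ∨ common adjacent vertex» is spelled with the END-POINTS: `(v, g) = (w, h)` as pro-vertices
(`v = w ∧ g⁻¹h ∈ closure ι(D_v)`), or `g = k·ι(c₁ e)·p`, `h = k·ι(c₂ e)·q` for a pro-node `k·ẽ_e` (`p, q` in the end-point
stabilisers; either orientation), or both adjacent to a common `(u, f)`.  BINDER LIST = VERBATIM the section hypothesis
`hA3tri` of abc-iut-L5-t11 gen 15's `Literature.IUT.HodgeTheaters.StableCurveTemperedDataOfSpecialFibreSec2A3Trichotomy`
(★ p506978, l. 160–187) with `(Gtp, Ghat, ι, Gsrc, π, GK, aug) := (Π^tp_j, Π̂_j, ι_j, Π^temp_{X_K}, q̂_j ∘ toHat, G_K,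
Π^temp_{X_K} ↠ G_K)` abstracted to parameters, so that the consumer's `hA3tri_j` IS `(Dd j).ArithCosetTreeTrichotomy …` by
`rfl` (the re-keying theorem lives with the consumer, under `Literature/IUT/HodgeTheaters/`, not here).

Filed as abc-iut-L3's GUEST by abc-iut-L5-t9 gen 8 (abc-iut-L3-lead INTERFACE RULING Q6′, 2026-08-27T08:39:31Z, NODES row
«NodNon:Prop3.9(i)»; cell abc-iut).  A PREDICATE ON THE DATA — CONDITIONAL-BY-NAME hypothesis of record when consumed;
naming the law ≠ discharging it; nothing of [NodNon] / [AbsTopII] / [SemiAnbd] is asserted or proved here; no instance,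
no notation; typed ≠ proved.
-/

namespace Literature.AnabelianGeometry.SemiGraphs

open scoped Pointwise

universe uE

namespace DecompositionData

variable {Gtp : Type*} [Group Gtp] {V : Type*} {B : Type*}

/-- **[NodNon] Prop. 3.9 (i) in arithmetic coset coordinates** («`D_ṽ₁ ∩ D_ṽ₂ ≠ {1}` ⇒ `δ(ṽ₁, ṽ₂) ≤ 2`: the pro-vertices
coincide, are adjacent, or admit a common adjacent pro-vertex», ms p. 48 l. 10–25; = [AbsTopII] Prop. 1.3 (iv) p. 11
with its refined clauses) for the [SemiAnbd] §5 data `D` (p. 65), the map `ι : Π^temp_𝔊 → Ghat` to the profinite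
ambient (stabilisers = CLOSURES `closure ι(D_v)`), a source group `Gsrc` mapped to `Ghat` by `π` and augmented to `GK`
by `aug` (the compact non-trivial `Λ ≤ Gsrc` with OPEN `aug`-image play «`D_ṽ₁ ∩ D_ṽ₂ ≠ {1}` after restricting to the
inertia»), quantified over ALL endpoint data of `D` ([NodNon] Def 1.1 (vi), Lem 1.7 / Lem 1.8).  The arithmetic twin of
`PSCDatum.VerticialIntersectionNear` (F-2540).  A predicate on the data; not asserted.
[cite: HoshiMochizukiNodNon2011, Prop 3.9 (i) p.48] -/
def ArithCosetTreeTrichotomy (D : DecompositionData Gtp V B)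
    {Ghat : Type*} [Group Ghat] [TopologicalSpace Ghat] [IsTopologicalGroup Ghat] (ι : Gtp →* Ghat)
    {Gsrc : Type*} [Group Gsrc] [TopologicalSpace Gsrc] (π : Gsrc →* Ghat)
    {GK : Type*} [Group GK] [TopologicalSpace GK] (aug : Gsrc →* GK) : Prop :=
  ∀ (E : Type uE) (β₁ β₂ : E → B) (src tgt : E → V) (c₁ c₂ : E → Gtp),
    (∀ e, D.edgeOf (β₁ e) = D.edgeOf (β₂ e)) → (∀ e, β₁ e ≠ β₂ e) →
    (∀ e, D.abut (β₁ e) = some (src e)) → (∀ e, D.abut (β₂ e) = some (tgt e)) →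
    (∀ e, MulAut.conj (c₁ e) • D.brGp (β₁ e) = MulAut.conj (c₂ e) • D.brGp (β₂ e)) →
    (∀ e, src e = tgt e → (c₁ e)⁻¹ * c₂ e ∉ D.vertGp (src e)) →
    (∀ (b b' : B) (v w : V), D.edgeOf b = D.edgeOf b' → b ≠ b' →
      D.abut b = some v → D.abut b' = some w → ∃ e, (β₁ e = b ∧ β₂ e = b') ∨ (β₁ e = b' ∧ β₂ e = b)) →
    ∀ (Λ : Subgroup Gsrc), IsCompact (Λ : Set Gsrc) → Λ ≠ ⊥ →
    IsOpen (Λ.map aug : Set GK) →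
    ∀ (v w : V) (g h γ : Ghat),
      MulAut.conj γ • Λ.map π ≤ MulAut.conj g • ((D.vertGp v).map ι).topologicalClosure →
      MulAut.conj γ • Λ.map π ≤ MulAut.conj h • ((D.vertGp w).map ι).topologicalClosure →
        (v = w ∧ g⁻¹ * h ∈ ((D.vertGp v).map ι).topologicalClosure) ∨
        (∃ (e : E) (k : Ghat), ∃ p ∈ ((D.vertGp (src e)).map ι).topologicalClosure,
              ∃ q ∈ ((D.vertGp (tgt e)).map ι).topologicalClosure,
              (src e = v ∧ tgt e = w ∧ g = k * ι (c₁ e) * p ∧ h = k * ι (c₂ e) * q) ∨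
              (src e = w ∧ tgt e = v ∧ h = k * ι (c₁ e) * p ∧ g = k * ι (c₂ e) * q)) ∨
        (∃ (u : V) (f : Ghat),
          (∃ (e : E) (k : Ghat), ∃ p ∈ ((D.vertGp (src e)).map ι).topologicalClosure,
              ∃ q ∈ ((D.vertGp (tgt e)).map ι).topologicalClosure,
              (src e = v ∧ tgt e = u ∧ g = k * ι (c₁ e) * p ∧ f = k * ι (c₂ e) * q) ∨
              (src e = u ∧ tgt e = v ∧ f = k * ι (c₁ e) * p ∧ g = k * ι (c₂ e) * q)) ∧
          (∃ (e : E) (k : Ghat), ∃ p ∈ ((D.vertGp (src e)).map ι).topologicalClosure,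
              ∃ q ∈ ((D.vertGp (tgt e)).map ι).topologicalClosure,
              (src e = u ∧ tgt e = w ∧ f = k * ι (c₁ e) * p ∧ h = k * ι (c₂ e) * q) ∨
              (src e = w ∧ tgt e = u ∧ h = k * ι (c₁ e) * p ∧ f = k * ι (c₂ e) * q)))

end DecompositionData

end Literature.AnabelianGeometry.SemiGraphs
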